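import Summits.QuantumAdvantage.AdviceFreeQNC0.TwoBlindSpotsFibre
import HarnessLib

/-!
# Cell qa-qnc0 (rung F-Q1, route RingFrame, crux α `RingToElim`): TWO BLIND SPOTS, part 2 — a block
# of cuts that fails to read two outside bits is beaten (planner qa-qnc0-p1's THEOREM-TARGET T8)

Walk game in walk coordinates (`ringWinU`, charge `c`), input `u = a ++ z ++ b` (`glue3`) with the
block `z` of `M` bits at `[p, p + M)`.  Suppose the selectors at the cuts STRICTLY INSIDE the block
(`p < g < p + M`) do not read two bit positions `i ≠ j` OUTSIDE the block (flipping `u_i` or `u_j`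
does not change them); everything else — the outside selectors, the two block ends, and what else
the interior selectors read — is unrestricted beyond degree `≤ D ≤ c₁√M`.  Then the strategy wins
on at most `(1 − η₀/4)·2^{p+M+q}` inputs (`ringWinU_twoBlind_glue3_le`), `η₀` the two-bit
elimination constant of `EliminationHardness.lean`.

Mechanism (T8, qa-qnc0-p1 gen 11, ROUND-10 / Sketch11 §23; the density-`1/4` offset count of the
sketch is replaced by a four-flip orbit).  By part 1 (`TwoBlindSpotsFibre.lean`) the fibre `(a, b)`
loses on `≥ distFail D (B_{c'})` block contents, `B` its interior triple, `c' = c + p + 2|a| + |b|`.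
* `flipOut` — flipping ONE outside bit of `(a, b)`: `B` is unchanged (the interior cuts do not read
  the bit, `inStrategy_flipOut_interior`) while `c'` moves by `ε ∈ {1, 2} (mod 3)`
  (`inCharge_flipOut`, `wt_update_not`); `glue3_flipOut` identifies the glued flipped pair.
* `distFail_zero_le_four` — the four-flip orbit `{ab, φ_i ab, φ_j ab, φ_j φ_i ab}` has offsets
  `c' + {0, ε_i, ε_j, ε_i + ε_j}` covering `ℤ/3`, so its four loss counts add up to
  `≥ distFail D (B_0) + distFail D (B_1) + distFail D (B_2) ≥ distFail D 0` (`potential_cost`,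
  `B` even) `≥ η₀·2^M` (`le_distFail_zero_of` + `elimSqrtDec_of_lowDegAvoidMod3Sparse`).
* The three flips are bijections (`flipOutPerm`), so `4·#LOSS ≥ 2^{p+q}·η₀·2^M`.

Strictly contains the cross-free window theorem (`ringWinU_crossFree_sqrt_le`: its hypothesis on
the `x`-interior selectors is dropped and `L ≥ n₀` becomes two bits), hence the blind-window and
local-rules theorems; the Sketch11 forms are derived in `TwoBlindSpotsForms.lean`.  The cell's
theorem (planner qa-qnc0-p1 gen 11, prover qa-qnc0-prover gen 6, 2026-08-27); not in print.
WHAT THIS IS NOT: nothing on TOTALLY SIGHTED strategies (α proper); `η₀` is tiny; no separation.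

## References

* S. Srinivasan, *A robust version of Hegedűs's lemma, with applications*, TheoretiCS 2 (2023),
  Lemma 3.1 [Srinivasan2023] (through `elimSqrtDec_of_lowDegAvoidMod3Sparse`).
-/


noncomputable section

namespace Summit.QuantumAdvantage.AdviceFreeQNC0

open Finset
open Literature.Computability.MetaComplexity Literature.Computability.MetaComplexity.Smolensky

/-- Flipping one bit moves the weight by one:
`|update u k (¬u_k)| + [u_k] = |u| + [¬u_k]`. [folklore] -/
theorem wt_update_not {n : ℕ} (u : Fin n → Bool) (k : Fin n) :
    wt (Function.update u k (!u k)) + (if u k = true then 1 else 0) =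
      wt u + (if u k = true then 0 else 1) := by
  classical
  have hsum : ∀ v : Fin n → Bool, wt v = ∑ i, (if v i = true then 1 else 0) := fun v => by
    unfold wt; rw [Finset.card_filter]
  rw [hsum, hsum, ← Finset.add_sum_erase _ _ (Finset.mem_univ k),
    ← Finset.add_sum_erase _ _ (Finset.mem_univ k), Function.update_self]
  have hrest : ∑ i ∈ univ.erase k, (if Function.update u k (!u k) i = true then 1 else 0) =
      ∑ i ∈ univ.erase k, (if u i = true then 1 else 0) :=
    Finset.sum_congr rfl fun i hi => by rw [Function.update_of_ne (Finset.ne_of_mem_erase hi)]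
  rw [hrest]
  cases u k <;> simp <;> omega

variable {M p q : ℕ}

/-! ### Flipping one outside bit -/

/-- Flip the outside bit at absolute position `i` of the pair `(a, b)` (`i < p`: bit `i` of `a`;
`p + M ≤ i < p + M + q`: bit `i − (p + M)` of `b`; otherwise nothing). -/
def flipOut (M i : ℕ) (ab : (Fin p → Bool) × (Fin q → Bool)) : (Fin p → Bool) × (Fin q → Bool) :=
  if h : i < p then (Function.update ab.1 ⟨i, h⟩ (!ab.1 ⟨i, h⟩), ab.2)
  else if h' : p + M ≤ i ∧ i < p + M + q then
    (ab.1, Function.update ab.2 ⟨i - (p + M), by omega⟩ (!ab.2 ⟨i - (p + M), by omega⟩))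
  else ab

/-- The offset move of the flip at `i`: `ε = 1` or `2` (mod `3`) according to the flipped bit and
its side (`c' = c + p + 2|a| + |b|`); `0` if `i` is not an outside position. -/
def flipEps (M i : ℕ) (ab : (Fin p → Bool) × (Fin q → Bool)) : ℕ :=
  if h : i < p then (if ab.1 ⟨i, h⟩ = true then 1 else 2)
  else if h' : p + M ≤ i ∧ i < p + M + q then
    (if ab.2 ⟨i - (p + M), by omega⟩ = true then 2 else 1)
  else 0

/-- Flipping twice is the identity. -/
theorem flipOut_flipOut (M i : ℕ) (ab : (Fin p → Bool) × (Fin q → Bool)) :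
    flipOut M i (flipOut M i ab) = ab := by
  obtain ⟨a, b⟩ := ab
  unfold flipOut
  by_cases h : i < p
  · simp only [dif_pos h, Function.update_self, Bool.not_not, Function.update_idem,
      Function.update_eq_self]
  · by_cases h' : p + M ≤ i ∧ i < p + M + q
    · simp only [dif_neg h, dif_pos h', Function.update_self, Bool.not_not, Function.update_idem,
        Function.update_eq_self]
    · simp only [dif_neg h, dif_neg h']

/-- The flip as a permutation of the outside patterns. -/
def flipOutPerm (M i : ℕ) : Equiv.Perm ((Fin p → Bool) × (Fin q → Bool)) :=
  Function.Involutive.toPerm (flipOut M i) (flipOut_flipOut M i)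

/-- An outside flip moves the fibre charge by a NON-ZERO residue:
`c'(φ_i ab) ≡ c'(ab) + ε_i(ab)`, `ε_i(ab) ≢ 0 (mod 3)`. -/
theorem inCharge_flipOut (c : ℕ) {M i : ℕ} (hi : i < p ∨ (p + M ≤ i ∧ i < p + M + q))
    (ab : (Fin p → Bool) × (Fin q → Bool)) :
    inCharge (p := p) (q := q) c (flipOut M i ab).1 (flipOut M i ab).2 % 3 =
        (inCharge c ab.1 ab.2 + flipEps M i ab) % 3 ∧
      flipEps M i ab % 3 ≠ 0 := by
  obtain ⟨a, b⟩ := ab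
  unfold flipOut flipEps inCharge
  by_cases h : i < p
  · simp only [dif_pos h]
    have hw := wt_update_not a ⟨i, h⟩
    constructor
    · split_ifs at hw ⊢ <;> omega
    · split_ifs <;> omega
  · have h' : p + M ≤ i ∧ i < p + M + q := by omega
    simp only [dif_neg h, dif_pos h']
    have hw := wt_update_not b ⟨i - (p + M), by omega⟩
    constructor
    · split_ifs at hw ⊢ <;> omega
    · split_ifs <;> omega

/-- Flipping bit `i` does not change the offset move of another position `j`. -/
theorem flipEps_flipOut_of_ne {M i j : ℕ} (hij : i ≠ j) (ab : (Fin p → Bool) × (Fin q → Bool)) :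
    flipEps (p := p) (q := q) M j (flipOut M i ab) = flipEps M j ab := by
  obtain ⟨a, b⟩ := ab
  unfold flipOut flipEps
  by_cases hi : i < p
  · simp only [dif_pos hi]
    by_cases hj : j < p
    · simp only [dif_pos hj]
      have hne : (⟨j, hj⟩ : Fin p) ≠ ⟨i, hi⟩ := fun e => hij (by
        have := congrArg Fin.val e; simp only at this; omega)
      rw [Function.update_of_ne hne]
    · simp only [dif_neg hj]
  · by_cases hi' : p + M ≤ i ∧ i < p + M + q
    · simp only [dif_neg hi, dif_pos hi']
      by_cases hj : j < p
      · simp only [dif_pos hj]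
      · simp only [dif_neg hj]
        by_cases hj' : p + M ≤ j ∧ j < p + M + q
        · simp only [dif_pos hj']
          have hne : (⟨j - (p + M), by omega⟩ : Fin q) ≠ ⟨i - (p + M), by omega⟩ := fun e => hij (by
            have := congrArg Fin.val e; simp only at this; omega)
          rw [Function.update_of_ne hne]
        · simp only [dif_neg hj']
    · simp only [dif_neg hi, dif_neg hi']

/-- **The flipped pair glues to the flipped input**: for an outside position `i`,
`(φ_i ab).1 ++ z ++ (φ_i ab).2 = update (a ++ z ++ b) i ¬(…)_i`. -/
theorem glue3_flipOut {M i : ℕ} (hi : i < p ∨ (p + M ≤ i ∧ i < p + M + q)) (hi' : i < p + M + q)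
    (ab : (Fin p → Bool) × (Fin q → Bool)) (z : Fin M → Bool) :
    glue3 (flipOut M i ab).1 z (flipOut M i ab).2 =
      Function.update (glue3 ab.1 z ab.2) ⟨i, hi'⟩ (!(glue3 ab.1 z ab.2 ⟨i, hi'⟩)) := by
  obtain ⟨a, b⟩ := ab
  funext k
  by_cases hk : k = ⟨i, hi'⟩
  · subst hk
    rw [Function.update_self]
    unfold flipOut glue3
    rcases hi with h | h
    · simp only [dif_pos h]
      have hk : (⟨i, hi'⟩ : Fin (p + M + q)) = Fin.castAdd q (Fin.castAdd M ⟨i, h⟩) := Fin.ext rfl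
      rw [hk, Fin.append_left, Fin.append_left, Fin.append_left, Fin.append_left,
        Function.update_self]
    · have hnp : ¬ i < p := by omega
      simp only [dif_neg hnp, dif_pos h]
      have hk : (⟨i, hi'⟩ : Fin (p + M + q)) = Fin.natAdd (p + M) ⟨i - (p + M), by omega⟩ :=
        Fin.ext (by simp; omega)
      rw [hk, Fin.append_right, Fin.append_right, Function.update_self]
  · rw [Function.update_of_ne hk]
    have hkv : k.val ≠ i := fun h => hk (Fin.ext h)
    unfold flipOut glue3
    rcases hi with h | h
    · simp only [dif_pos h]
      induction k using Fin.addCases with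
      | left k₁ =>
        rw [Fin.append_left, Fin.append_left]
        induction k₁ using Fin.addCases with
        | left k₀ =>
          rw [Fin.append_left, Fin.append_left]
          exact Function.update_of_ne (fun e => hkv (by
            have := congrArg Fin.val e; simpa using this)) _ _
        | right k₀ => rw [Fin.append_right, Fin.append_right]
      | right k₂ => rw [Fin.append_right, Fin.append_right]
    · have hnp : ¬ i < p := by omega
      simp only [dif_neg hnp, dif_pos h]
      induction k using Fin.addCases with
      | left k₁ => rw [Fin.append_left, Fin.append_left]
      | right k₂ =>
        rw [Fin.append_right, Fin.append_right]
        exact Function.update_of_ne (fun e => hkv (by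
          have := congrArg Fin.val e; simp at this; simp; omega)) _ _

/-- **Blind interior cuts do not notice an outside flip**: if the cuts strictly inside the block
do not read bit `i`, the interior window selectors of `φ_i ab` and of `ab` coincide. -/
theorem inStrategy_flipOut_interior {M : ℕ} (y : Fin (p + M + q + 1) → (Fin (p + M + q) → Bool) → Bool)
    (i : Fin (p + M + q)) (hi : i.val < p ∨ (p + M ≤ i.val ∧ i.val < p + M + q))
    (hI : ∀ g : Fin (p + M + q + 1), p < g.val → g.val < p + M →
      ∀ u, y g (Function.update u i (!u i)) = y g u)
    (ab : (Fin p → Bool) × (Fin q → Bool)) (g' : Fin (M + 1)) (h1 : 0 < g'.val) (h2 : g'.val < M) :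
    inStrategy y (flipOut M i.val ab).1 (flipOut M i.val ab).2 g' = inStrategy y ab.1 ab.2 g' := by
  funext z
  unfold inStrategy
  rw [glue3_flipOut hi i.isLt ab z]
  exact hI ⟨p + g'.val, by omega⟩ (show p < p + g'.val by omega) (show p + g'.val < p + M by omega) _

/-! ### Four offsets covering `ℤ/3` pay the full potential cost -/

/-- Three offsets with pairwise distinct residues: `distFail D 0 ≤ Σ distFail D (B t_k)` for an even
`3`-periodic triple `B` (`potential_cost`). -/
theorem distFail_zero_le_three {B : ℕ → (Fin M → Bool) → Bool}
    (hmod : ∀ s s', s % 3 = s' % 3 → B s = B s')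
    (heven : ∀ z, xor (B 0 z) (xor (B 1 z) (B 2 z)) = false) (D t0 t1 t2 : ℕ)
    (h01 : t0 % 3 ≠ t1 % 3) (h02 : t0 % 3 ≠ t2 % 3) (h12 : t1 % 3 ≠ t2 % 3) :
    distFail D (fun _ : Fin M → Bool => false) ≤ distFail D (B t0) + distFail D (B t1) + distFail D (B t2) := by
  refine potential_cost D (B t0) (B t1) (B t2) fun z => ?_
  have h0 : t0 % 3 = 0 ∨ t0 % 3 = 1 ∨ t0 % 3 = 2 := by omega
  have h1 : t1 % 3 = 0 ∨ t1 % 3 = 1 ∨ t1 % 3 = 2 := by omega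
  have h2 : t2 % 3 = 0 ∨ t2 % 3 = 1 ∨ t2 % 3 = 2 := by omega
  have e0 := hmod t0 (t0 % 3) (by omega)
  have e1 := hmod t1 (t1 % 3) (by omega)
  have e2 := hmod t2 (t2 % 3) (by omega)
  rw [e0, e1, e2]
  have hz := heven z
  rcases h0 with h0 | h0 | h0 <;> rcases h1 with h1 | h1 | h1 <;> rcases h2 with h2 | h2 | h2 <;>
    first
    | omega
    | (rw [h0, h1, h2]; revert hz; cases B 0 z <;> cases B 1 z <;> cases B 2 z <;> decide)

/-- **Four offsets `s, s + ε_i, s + ε_j, s + ε_i + ε_j` with `ε_i, ε_j ≢ 0 (mod 3)` cover `ℤ/3`**,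
so the four potential costs add up to at least `distFail D 0`. -/
theorem distFail_zero_le_four {B : ℕ → (Fin M → Bool) → Bool}
    (hmod : ∀ s s', s % 3 = s' % 3 → B s = B s')
    (heven : ∀ z, xor (B 0 z) (xor (B 1 z) (B 2 z)) = false) (D s εi εj : ℕ)
    (hi : εi % 3 ≠ 0) (hj : εj % 3 ≠ 0) :
    distFail D (fun _ : Fin M → Bool => false) ≤
      distFail D (B s) + distFail D (B (s + εi)) + distFail D (B (s + εj)) +
        distFail D (B (s + εi + εj)) := by
  by_cases he : εi % 3 = εj % 3
  · -- `ε_i ≡ ε_j`: `s, s + ε, s + 2ε` are the three residues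
    have := distFail_zero_le_three hmod heven D s (s + εi) (s + εi + εj) (by omega) (by omega) (by omega)
    omega
  · -- `ε_i + ε_j ≡ 0`: `s, s + ε_i, s + ε_j` are the three residues
    have := distFail_zero_le_three hmod heven D s (s + εi) (s + εj) (by omega) (by omega) (by omega)
    omega

/-! ### The theorem -/

/-- Fubini over the pair `(a, b)` as one variable. -/
private theorem card_filter_eq_sum_pair (P : (Fin (p + M + q) → Bool) → Prop) [DecidablePred P] :
    (univ.filter fun w : Fin (p + M + q) → Bool => P w).card =
      ∑ ab : (Fin p → Bool) × (Fin q → Bool),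
        (univ.filter fun z : Fin M → Bool => P (glue3 ab.1 z ab.2)).card := by
  rw [card_filter_eq_sum_glue3, Fintype.sum_prod_type]

/-- **TWO BLIND SPOTS (core, `a ++ z ++ b` form).**  There are `θ < 1`, `c₁ > 0`, `n₀` such that:
for every block length `M ≥ n₀`, degree `D ≤ c₁√M`, outside lengths `p, q`, two DISTINCT outside
bit positions `i, j` (each `< p` or `≥ p + M`), every charge `c` and every walk strategy `y` on
`p + M + q` bits with all selectors of degree `≤ D` whose cuts strictly inside the block
(`p < g < p + M`) do not read `u_i` and do not read `u_j` (flipping either bit leaves them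
unchanged), the ring game in walk coordinates is won on at most `θ·2^{p+M+q}` inputs.
(T8 of planner qa-qnc0-p1 gen 11; `θ = 1 − η₀/4`.) [cite: Srinivasan2023, Lemma 3.1] -/
theorem ringWinU_twoBlind_glue3_le :
    ∃ θ : ℝ, θ < 1 ∧ ∃ c₁ : ℝ, 0 < c₁ ∧ ∃ n₀ : ℕ, ∀ p M q : ℕ, n₀ ≤ M →
      ∀ D : ℕ, (D : ℝ) ≤ c₁ * Real.sqrt M →
      ∀ i j : Fin (p + M + q), i ≠ j → (i.val < p ∨ p + M ≤ i.val) → (j.val < p ∨ p + M ≤ j.val) →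
      ∀ (c : ℕ) (y : Fin (p + M + q + 1) → (Fin (p + M + q) → Bool) → Bool),
        (∀ g, HasDeg (y g) D) →
        (∀ g : Fin (p + M + q + 1), p < g.val → g.val < p + M →
          ∀ u, y g (Function.update u i (!u i)) = y g u) →
        (∀ g : Fin (p + M + q + 1), p < g.val → g.val < p + M →
          ∀ u, y g (Function.update u j (!u j)) = y g u) →
        ((univ.filter fun u : Fin (p + M + q) → Bool => ringWinU c y u = true).card : ℝ) ≤
          θ * (2 : ℝ) ^ (p + M + q) := by
  obtain ⟨η₀, hη₀, c₀, hc₀, n₀, H⟩ := elimSqrtDec_of_lowDegAvoidMod3Sparse lowDegAvoidMod3Sparse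
  refine ⟨1 - η₀ / 4, by linarith, c₀, hc₀, max n₀ 1, ?_⟩
  intro p M q hM D hD i j hij hi hj c y hdeg hI hJ
  have hMn₀ : n₀ ≤ M := le_trans (le_max_left _ _) hM
  have hM1 : 0 < M := lt_of_lt_of_le Nat.zero_lt_one (le_trans (le_max_right _ _) hM)
  have hi' : i.val < p ∨ (p + M ≤ i.val ∧ i.val < p + M + q) := by
    rcases hi with h | h
    · exact Or.inl h
    · exact Or.inr ⟨h, i.isLt⟩
  have hj' : j.val < p ∨ (p + M ≤ j.val ∧ j.val < p + M + q) := by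
    rcases hj with h | h
    · exact Or.inl h
    · exact Or.inr ⟨h, j.isLt⟩
  have hijv : i.val ≠ j.val := fun h => hij (Fin.ext h)
  -- the minimum fail weight on the block
  have hw : η₀ * (2 : ℝ) ^ M ≤ (distFail D (fun _ : Fin M → Bool => false) : ℝ) :=
    le_distFail_zero_of fun a b ha hb dec => H M hMn₀ D hD a b ha hb dec
  -- loss and win counts per fibre
  set Λ : (Fin p → Bool) × (Fin q → Bool) → ℕ := fun ab =>
    (univ.filter fun z : Fin M → Bool => ringWinU c y (glue3 ab.1 z ab.2) = false).card with hΛ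
  have hWΛ : ∀ ab : (Fin p → Bool) × (Fin q → Bool),
      (univ.filter fun z : Fin M → Bool => ringWinU c y (glue3 ab.1 z ab.2) = true).card + Λ ab =
        2 ^ M := by
    intro ab
    simp only [hΛ]
    have e : (univ.filter fun z : Fin M → Bool => ringWinU c y (glue3 ab.1 z ab.2) = false) =
        univ.filter fun z : Fin M → Bool => ¬ (ringWinU c y (glue3 ab.1 z ab.2) = true) :=
      Finset.filter_congr fun z _ => Bool.eq_false_iff
    rw [e, Finset.card_filter_add_card_filter_not, Finset.card_univ, Fintype.card_fun,
      Fintype.card_bool, Fintype.card_fin]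
  -- the interior triple of a fibre and its invariance under the two flips
  set B : (Fin p → Bool) × (Fin q → Bool) → ℕ → (Fin M → Bool) → Bool := fun ab s =>
    interiorPar s (inStrategy y ab.1 ab.2) with hB
  have hBi : ∀ ab, B (flipOut M i.val ab) = B ab := fun ab => by
    funext s
    exact interiorPar_congr (fun g' h1 h2 => inStrategy_flipOut_interior y i hi' hI ab g' h1 h2) s
  have hBj : ∀ ab, B (flipOut M j.val ab) = B ab := fun ab => by
    funext s
    exact interiorPar_congr (fun g' h1 h2 => inStrategy_flipOut_interior y j hj' hJ ab g' h1 h2) s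
  have hBmod : ∀ ab s s', s % 3 = s' % 3 → B ab s = B ab s' := fun ab s s' h =>
    interiorPar_congr_mod h _
  have hBeven : ∀ ab z, xor (B ab 0 z) (xor (B ab 1 z) (B ab 2 z)) = false := fun ab z =>
    interiorPar_even 0 _ z
  -- per fibre: loss ≥ potential cost of the interior triple at the fibre charge
  have hloss : ∀ ab : (Fin p → Bool) × (Fin q → Bool),
      distFail D (B ab (inCharge c ab.1 ab.2)) ≤ Λ ab := fun ab =>
    distFail_le_card_loss c y hM1 hdeg ab.1 ab.2
  -- the four-flip orbit pays `distFail D 0`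
  have horbit : ∀ ab : (Fin p → Bool) × (Fin q → Bool),
      distFail D (fun _ : Fin M → Bool => false) ≤
        Λ ab + Λ (flipOut M i.val ab) + Λ (flipOut M j.val ab) +
          Λ (flipOut M j.val (flipOut M i.val ab)) := by
    intro ab
    obtain ⟨hci, hεi⟩ := inCharge_flipOut c (M := M) hi' ab
    obtain ⟨hcj, hεj⟩ := inCharge_flipOut c (M := M) hj' ab
    obtain ⟨hcij, -⟩ := inCharge_flipOut c (M := M) hj' (flipOut M i.val ab)
    rw [flipEps_flipOut_of_ne hijv] at hcij
    have h4 := distFail_zero_le_four (hBmod ab) (hBeven ab) D (inCharge c ab.1 ab.2)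
      (flipEps M i.val ab) (flipEps M j.val ab) hεi hεj
    have e1 : B ab (inCharge c ab.1 ab.2 + flipEps M i.val ab) =
        B (flipOut M i.val ab) (inCharge c (flipOut M i.val ab).1 (flipOut M i.val ab).2) := by
      rw [hBi]; exact hBmod ab _ _ (by omega)
    have e2 : B ab (inCharge c ab.1 ab.2 + flipEps M j.val ab) =
        B (flipOut M j.val ab) (inCharge c (flipOut M j.val ab).1 (flipOut M j.val ab).2) := by
      rw [hBj]; exact hBmod ab _ _ (by omega)
    have e3 : B ab (inCharge c ab.1 ab.2 + flipEps M i.val ab + flipEps M j.val ab) =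
        B (flipOut M j.val (flipOut M i.val ab))
          (inCharge c (flipOut M j.val (flipOut M i.val ab)).1
            (flipOut M j.val (flipOut M i.val ab)).2) := by
      rw [hBj, hBi]; exact hBmod ab _ _ (by omega)
    rw [e1, e2, e3] at h4
    have l0 := hloss ab
    have l1 := hloss (flipOut M i.val ab)
    have l2 := hloss (flipOut M j.val ab)
    have l3 := hloss (flipOut M j.val (flipOut M i.val ab))
    omega
  -- sum over the orbit: the flips are bijections
  have hsum_i : ∑ ab, Λ (flipOut M i.val ab) = ∑ ab, Λ ab :=
    Equiv.sum_comp (flipOutPerm (p := p) (q := q) M i.val) Λ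
  have hsum_j : ∑ ab, Λ (flipOut M j.val ab) = ∑ ab, Λ ab :=
    Equiv.sum_comp (flipOutPerm (p := p) (q := q) M j.val) Λ
  have hsum_ij : ∑ ab, Λ (flipOut M j.val (flipOut M i.val ab)) = ∑ ab, Λ ab := by
    rw [show (∑ ab, Λ (flipOut M j.val (flipOut M i.val ab))) =
        ∑ ab, (fun ab' => Λ (flipOut M j.val ab')) (flipOutPerm (p := p) (q := q) M i.val ab)
        from rfl, Equiv.sum_comp (flipOutPerm (p := p) (q := q) M i.val) (fun ab' => Λ (flipOut M j.val ab'))]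
    exact hsum_j
  have h4sum : 2 ^ (p + q) * distFail D (fun _ : Fin M → Bool => false) ≤
      4 * ∑ ab : (Fin p → Bool) × (Fin q → Bool), Λ ab := by
    calc 2 ^ (p + q) * distFail D (fun _ : Fin M → Bool => false)
        = ∑ _ab : (Fin p → Bool) × (Fin q → Bool), distFail D (fun _ : Fin M → Bool => false) := by
          rw [Finset.sum_const, Finset.card_univ, smul_eq_mul, Fintype.card_prod, Fintype.card_fun,
            Fintype.card_fun, Fintype.card_bool, Fintype.card_fin, Fintype.card_fin, pow_add]
      _ ≤ ∑ ab : (Fin p → Bool) × (Fin q → Bool), (Λ ab + Λ (flipOut M i.val ab) +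
            Λ (flipOut M j.val ab) + Λ (flipOut M j.val (flipOut M i.val ab))) :=
          Finset.sum_le_sum fun ab _ => horbit ab
      _ = 4 * ∑ ab : (Fin p → Bool) × (Fin q → Bool), Λ ab := by
          rw [Finset.sum_add_distrib, Finset.sum_add_distrib, Finset.sum_add_distrib, hsum_i, hsum_j,
            hsum_ij]
          ring
  -- assemble
  have hwin : ((univ.filter fun u : Fin (p + M + q) → Bool => ringWinU c y u = true).card : ℝ) +
      ∑ ab : (Fin p → Bool) × (Fin q → Bool), (Λ ab : ℝ) = (2 : ℝ) ^ (p + M + q) := by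
    rw [card_filter_eq_sum_pair]
    push_cast
    rw [← Finset.sum_add_distrib]
    have : ∀ ab : (Fin p → Bool) × (Fin q → Bool),
        (((univ.filter fun z : Fin M → Bool => ringWinU c y (glue3 ab.1 z ab.2) = true).card : ℝ) +
          (Λ ab : ℝ)) = (2 : ℝ) ^ M := fun ab => by exact_mod_cast hWΛ ab
    rw [Finset.sum_congr rfl fun ab _ => this ab, Finset.sum_const, Finset.card_univ, nsmul_eq_mul,
      Fintype.card_prod, Fintype.card_fun, Fintype.card_fun, Fintype.card_bool, Fintype.card_fin,
      Fintype.card_fin]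
    push_cast
    ring
  have h4sumR : (2 : ℝ) ^ (p + q) * (distFail D (fun _ : Fin M → Bool => false) : ℝ) ≤
      4 * ∑ ab : (Fin p → Bool) × (Fin q → Bool), (Λ ab : ℝ) := by exact_mod_cast h4sum
  have hpow : (2 : ℝ) ^ (p + M + q) = (2 : ℝ) ^ (p + q) * (2 : ℝ) ^ M := by
    rw [← pow_add]; congr 1; omega
  have hpos : (0 : ℝ) ≤ (2 : ℝ) ^ (p + q) := by positivity
  nlinarith [mul_le_mul_of_nonneg_left hw hpos]

end Summit.QuantumAdvantage.AdviceFreeQNC0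

end
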